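import Mathlib
import Literature.MathematicalPhysics.QuantumFieldTheory.YangMillsOS
import Literature.MathematicalPhysics.QuantumFieldTheory.SpeciesLatticeProducts
import Literature.MathematicalPhysics.QuantumFieldTheory.LatticeGaugeProofs
import Literature.MathematicalPhysics.QuantumLattice.WilsonFeynmanHellmann
import HarnessLib

/-!
# Line `Sketch` (holomorphic coupling response) of crux `HypercubicLimit` — stub 2.2:
# Cauchy transfer at order 1

Support file for crux `stmt-QuantumFields-16154` (`CoincidenceRotationBootstrap.HypercubicLimit` =
`MirrorModularBoosts.WeakCouplingHypercubicLimit`), line `Sketch` (card `holomorphic-coupling-response`),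
registered stub `stub_cauchyTransfer` of `Cruxes/HypercubicLimit/Lines/Sketch.lean` (the card's first
lemma).

With `μ_k = wilsonMeasure r.ρ (sch.β k)` the Wilson measure of the scheme at step `k` and
`Φ_k(f) U = smearedLatticeField r.curvature.F (box 4 L_k) a_k c_k m_k f (torusLift (sch.side k) U)` the
smeared renormalised curvature field, the order-1 complex-source RESPONSE is
`Q(t) = (∫ Φ_k(f₀) e^{t Φ_k(f₁)} dμ_k) / (∫ e^{t Φ_k(f₁)} dμ_k)` (`t : ℂ`).  If `Q` is holomorphic on the
disc `|t| < ε` and bounded there by `B`, then `|Cov_{μ_k}(Φ_k(f₀), Φ_k(f₁))| ≤ B / ε`.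

Proof: on the real axis `Q` is the tilted expectation `t ↦ ∫ Φ_k(f₀) d(μ_k.tilted (t Φ_k(f₁)))`
(`integral_tilted_eq_integral_mul_exp_div_mgf`), whose derivative at `0` is the covariance
(fluctuation–response `hasDerivAt_integral_tilted_eq_covariance` at `t = 0`, the content of stub 2.1
`stub_fluctuationResponse`, re-derived here in one line so that this file does not depend on the stub-2.1
module); by uniqueness of the derivative of
`t ↦ Q t` along the real axis (`HasDerivAt.comp_ofReal`, `HasDerivAt.ofReal_comp`) the complex derivative
`deriv Q 0` is the covariance; Cauchy's estimate (`Complex.norm_deriv_le_of_forall_mem_sphere_norm_le`) on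
the circles `|t| = ρ < ε` gives `|Cov| ≤ B / ρ`, and `ρ → ε`.

* `cauchyTransfer_response_ofReal` — the complex response at a real source is the tilted expectation
  (private helper);
* `cauchyTransfer_hasDerivAt_tilted_zero` — fluctuation–response at `t = 0` for bounded observables on a
  probability space (private helper);
* `cauchyTransfer_abs_covariance_le` — the abstract Cauchy transfer on a measure space, taking the
  real-axis fluctuation–response identity as a hypothesis (private helper);
* `stub_cauchyTransfer` — the registered stub (tree vocabulary).
-/

noncomputable section

open scoped SchwartzMap
open MeasureTheory ProbabilityTheory Filter Topology
open Literature.MathematicalPhysics.QuantumLattice Literature.MathematicalPhysics.QuantumFieldTheory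

namespace Summit.QuantumFields.YangMills.Cruxes.HypercubicLimit.CouplingResponse

/-- **The complex response at a real source is the tilted expectation**: for real `t`,
`(∫ F e^{tX} dμ) / (∫ e^{tX} dμ) = ∫ F d(μ.tilted (t X))`, both sides read in `ℂ`
(`integral_tilted_eq_integral_mul_exp_div_mgf`, the denominator being `mgf X μ t`). [folklore] -/
private theorem cauchyTransfer_response_ofReal {Ω : Type*} {mΩ : MeasurableSpace Ω}
    (μ : Measure Ω) (F X : Ω → ℝ) (t : ℝ) :
    (∫ ω, ((F ω : ℝ) : ℂ) * Complex.exp ((t : ℂ) * ((X ω : ℝ) : ℂ)) ∂μ) /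
        ∫ ω, Complex.exp ((t : ℂ) * ((X ω : ℝ) : ℂ)) ∂μ =
      ((∫ ω, F ω ∂(μ.tilted (fun ω => t * X ω)) : ℝ) : ℂ) := by
  have h1 : (fun ω => ((F ω : ℝ) : ℂ) * Complex.exp ((t : ℂ) * ((X ω : ℝ) : ℂ))) =
      fun ω => ((F ω * Real.exp (t * X ω) : ℝ) : ℂ) := by
    funext ω
    push_cast
    rfl
  have h2 : (fun ω => Complex.exp ((t : ℂ) * ((X ω : ℝ) : ℂ))) =
      fun ω => ((Real.exp (t * X ω) : ℝ) : ℂ) := by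
    funext ω
    push_cast
    rfl
  rw [integral_tilted_eq_integral_mul_exp_div_mgf F t, Complex.ofReal_div, h1, h2,
    integral_complex_ofReal, integral_complex_ofReal]
  rfl

/-- **Cauchy transfer at order 1** (abstract form).  Let `μ` be a measure, `F`, `X` real observables,
and `Q(t) = (∫ F e^{tX} dμ) / (∫ e^{tX} dμ)` (`t : ℂ`) the complex-source response.  If the real tilted
expectation `t ↦ ∫ F d(μ.tilted (t X))` has derivative `Cov_μ(F, X)` at `0` (fluctuation–response), and
`Q` is holomorphic on the disc `|t| < ε` and bounded there by `B`, then `|Cov_μ(F, X)| ≤ B / ε`: the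
complex derivative `deriv Q 0` equals the covariance (uniqueness of the derivative along the real axis,
where `Q` is the tilted expectation), and Cauchy's estimate on the circles `|t| = ρ < ε` gives
`|Cov| ≤ B / ρ`; let `ρ → ε`. [folklore] -/
private theorem cauchyTransfer_abs_covariance_le {Ω : Type*} {mΩ : MeasurableSpace Ω}
    (μ : Measure Ω) (F X : Ω → ℝ) {ε B : ℝ} (hε : 0 < ε)
    (hderiv : HasDerivAt (fun t : ℝ => ∫ ω, F ω ∂(μ.tilted (fun ω => t * X ω))) (cov[F, X; μ]) 0)
    (hQ : DifferentiableOn ℂ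
      (fun t : ℂ => (∫ ω, ((F ω : ℝ) : ℂ) * Complex.exp (t * ((X ω : ℝ) : ℂ)) ∂μ) /
        ∫ ω, Complex.exp (t * ((X ω : ℝ) : ℂ)) ∂μ) (Metric.ball 0 ε))
    (hB : ∀ t ∈ Metric.ball (0 : ℂ) ε,
      ‖(∫ ω, ((F ω : ℝ) : ℂ) * Complex.exp (t * ((X ω : ℝ) : ℂ)) ∂μ) /
        ∫ ω, Complex.exp (t * ((X ω : ℝ) : ℂ)) ∂μ‖ ≤ B) :
    |cov[F, X; μ]| ≤ B / ε := by
  set Q : ℂ → ℂ := fun t : ℂ => (∫ ω, ((F ω : ℝ) : ℂ) * Complex.exp (t * ((X ω : ℝ) : ℂ)) ∂μ) /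
      ∫ ω, Complex.exp (t * ((X ω : ℝ) : ℂ)) ∂μ with hQdef
  -- (i)-(ii) on the real axis `Q` is the tilted expectation, with derivative the covariance at `0`
  have hreal : HasDerivAt (fun t : ℝ => Q (t : ℂ)) ((cov[F, X; μ] : ℝ) : ℂ) 0 := by
    have hfun : (fun t : ℝ => Q (t : ℂ)) =
        fun t : ℝ => ((∫ ω, F ω ∂(μ.tilted (fun ω => t * X ω)) : ℝ) : ℂ) :=
      funext fun t => cauchyTransfer_response_ofReal μ F X t
    rw [hfun]
    exact hderiv.ofReal_comp
  -- (iii) `Q` is complex differentiable at `0`; its complex derivative is the covariance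
  have hdiff : DifferentiableAt ℂ Q 0 :=
    hQ.differentiableAt (Metric.isOpen_ball.mem_nhds (Metric.mem_ball_self hε))
  have hcplx : HasDerivAt (fun t : ℝ => Q (t : ℂ)) (deriv Q 0) 0 := by
    have h : HasDerivAt Q (deriv Q 0) ((0 : ℝ) : ℂ) := by
      rw [Complex.ofReal_zero]
      exact hdiff.hasDerivAt
    exact h.comp_ofReal
  have hdq : deriv Q 0 = ((cov[F, X; μ] : ℝ) : ℂ) := hcplx.unique hreal
  -- (iv) Cauchy's estimate on the circles of radius `ρ < ε`
  have key : ∀ ρ ∈ Set.Ioo 0 ε, |cov[F, X; μ]| * ρ ≤ B := by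
    intro ρ hρ
    have hd : DiffContOnCl ℂ Q (Metric.ball 0 ρ) :=
      (hQ.mono (Metric.closure_ball_subset_closedBall.trans
        (Metric.closedBall_subset_ball hρ.2))).diffContOnCl
    have hC : ∀ z ∈ Metric.sphere (0 : ℂ) ρ, ‖Q z‖ ≤ B := fun z hz =>
      hB z (Metric.sphere_subset_ball hρ.2 hz)
    have h := Complex.norm_deriv_le_of_forall_mem_sphere_norm_le hρ.1 hd hC
    rw [hdq, Complex.norm_real, Real.norm_eq_abs] at h
    exact (le_div_iff₀ hρ.1).1 h
  -- (v) let `ρ → ε`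
  have hlim : Tendsto (fun ρ : ℝ => |cov[F, X; μ]| * ρ) (𝓝[<] ε) (𝓝 (|cov[F, X; μ]| * ε)) :=
    ((continuous_const.mul continuous_id).tendsto ε).mono_left nhdsWithin_le_nhds
  have hev : ∀ᶠ ρ in 𝓝[<] ε, |cov[F, X; μ]| * ρ ≤ B := by
    filter_upwards [Ioo_mem_nhdsLT hε] with ρ hρ using key ρ hρ
  exact (le_div_iff₀ hε).2 (le_of_tendsto hlim hev)

/-- **Fluctuation–response at `t = 0`** (abstract form): on a probability space, for a bounded
measurable observable `F` and a bounded measurable tilting variable `X`, the real function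
`t ↦ ∫ F d(μ.tilted (t X))` has derivative `Cov_μ(F, X)` at `0` (`hasDerivAt_integral_tilted_eq_covariance`
at `t = 0`, where `integrableExpSet X μ = ℝ` because `X` is bounded, and `μ.tilted 0 = μ`). [folklore] -/
private theorem cauchyTransfer_hasDerivAt_tilted_zero {Ω : Type*} {mΩ : MeasurableSpace Ω}
    {μ : Measure Ω} [IsProbabilityMeasure μ] {F X : Ω → ℝ} (hF : Measurable F) (hX : Measurable X)
    {C K : ℝ} (hC : ∀ ω, |F ω| ≤ C) (hK : ∀ ω, |X ω| ≤ K) :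
    HasDerivAt (fun t : ℝ => ∫ ω, F ω ∂(μ.tilted (fun ω => t * X ω))) (cov[F, X; μ]) 0 := by
  have h0 : (0 : ℝ) ∈ interior (integrableExpSet X μ) := by
    rw [integrableExpSet_eq_univ_of_abs_le hX.aemeasurable (ae_of_all _ hK), interior_univ]
    exact Set.mem_univ _
  have h := hasDerivAt_integral_tilted_eq_covariance (μ := μ) (X := X) (F := F) (C := C) h0
    hF.aestronglyMeasurable (ae_of_all _ fun ω => by rw [Real.norm_eq_abs]; exact hC ω)
  have htilt : μ.tilted (fun ω => (0 : ℝ) * X ω) = μ := by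
    simp only [zero_mul]
    exact tilted_const μ 0
  rwa [htilt] at h

/-- **Stub 2.2 of line `Sketch` — Cauchy transfer at order 1 (the card's first lemma).**  If the
order-1 complex-source response `t ↦ (∫ Φ_k(f₀) e^{t Φ_k(f₁)} dμ_k)/(∫ e^{t Φ_k(f₁)} dμ_k)` of the
smeared renormalised curvature field under the Wilson measure `μ_k = wilsonMeasure r.ρ (sch.β k)` is
holomorphic on the disc `|t| < ε` and bounded there by `B`, then `|Cov_k(Φ_k(f₀), Φ_k(f₁))| ≤ B/ε`: its
complex derivative at `0` is the covariance (fluctuation–response at `t = 0` — the content of stub 2.1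
`stub_fluctuationResponse`: `μ_k` is a probability measure by `isProbabilityMeasure_wilsonMeasure`, the
fields are measurable and bounded by `measurable_smearedLatticeField_torusLift`,
`exists_bound_smearedLatticeField` — read on the real axis, where the response is the tilted expectation,
plus uniqueness of the derivative), and Cauchy's estimate
`Complex.norm_deriv_le_of_forall_mem_sphere_norm_le` on the circles `|t| = ρ < ε`, `ρ → ε`, bounds it.
Cauchy estimate for the truncated functions generated by a holomorphic coupling response (standard
high-temperature / analyticity bookkeeping, e.g. B. Simon, The Statistical Mechanics of Lattice Gases I,
Princeton 1993, §II.1, §V). [folklore] -/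
theorem stub_cauchyTransfer :
    ∀ (G : Type) [Group G] [TopologicalSpace G] [IsTopologicalGroup G] [CompactSpace G]
      [MeasurableSpace G] [BorelSpace G] (r : LatticeRep G) (sch : SpeciesScheme (YMSpecies G))
      (k : ℕ) (f₀ f₁ : 𝓢(EuclideanSpace ℝ (Fin 4), ℝ)) (ε B : ℝ), 0 < ε →
      DifferentiableOn ℂ
        (fun t : ℂ =>
          (∫ U, ((smearedLatticeField r.curvature.F
              (Literature.Probability.LatticeModels.box 4 (sch.L k)) (sch.a k) (sch.c r.curvature k)
              (sch.m r.curvature k) f₀ (torusLift (sch.side k) U) : ℝ) : ℂ) *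
            Complex.exp (t * ((smearedLatticeField r.curvature.F
              (Literature.Probability.LatticeModels.box 4 (sch.L k)) (sch.a k) (sch.c r.curvature k)
              (sch.m r.curvature k) f₁ (torusLift (sch.side k) U) : ℝ) : ℂ))
            ∂(wilsonMeasure r.ρ (sch.β k) : Measure (GaugeConfig 4 (sch.side k) G))) /
          ∫ U, Complex.exp (t * ((smearedLatticeField r.curvature.F
              (Literature.Probability.LatticeModels.box 4 (sch.L k)) (sch.a k) (sch.c r.curvature k)
              (sch.m r.curvature k) f₁ (torusLift (sch.side k) U) : ℝ) : ℂ))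
            ∂(wilsonMeasure r.ρ (sch.β k) : Measure (GaugeConfig 4 (sch.side k) G)))
        (Metric.ball 0 ε) →
      (∀ t ∈ Metric.ball (0 : ℂ) ε,
        ‖(∫ U, ((smearedLatticeField r.curvature.F
              (Literature.Probability.LatticeModels.box 4 (sch.L k)) (sch.a k) (sch.c r.curvature k)
              (sch.m r.curvature k) f₀ (torusLift (sch.side k) U) : ℝ) : ℂ) *
            Complex.exp (t * ((smearedLatticeField r.curvature.F
              (Literature.Probability.LatticeModels.box 4 (sch.L k)) (sch.a k) (sch.c r.curvature k)
              (sch.m r.curvature k) f₁ (torusLift (sch.side k) U) : ℝ) : ℂ))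
            ∂(wilsonMeasure r.ρ (sch.β k) : Measure (GaugeConfig 4 (sch.side k) G))) /
          ∫ U, Complex.exp (t * ((smearedLatticeField r.curvature.F
              (Literature.Probability.LatticeModels.box 4 (sch.L k)) (sch.a k) (sch.c r.curvature k)
              (sch.m r.curvature k) f₁ (torusLift (sch.side k) U) : ℝ) : ℂ))
            ∂(wilsonMeasure r.ρ (sch.β k) : Measure (GaugeConfig 4 (sch.side k) G))‖ ≤ B) →
      |covariance
          (fun U => smearedLatticeField r.curvature.F
            (Literature.Probability.LatticeModels.box 4 (sch.L k)) (sch.a k) (sch.c r.curvature k)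
            (sch.m r.curvature k) f₀ (torusLift (sch.side k) U))
          (fun U => smearedLatticeField r.curvature.F
            (Literature.Probability.LatticeModels.box 4 (sch.L k)) (sch.a k) (sch.c r.curvature k)
            (sch.m r.curvature k) f₁ (torusLift (sch.side k) U))
          (wilsonMeasure r.ρ (sch.β k) : Measure (GaugeConfig 4 (sch.side k) G))| ≤ B / ε := by
  intro G _ _ _ _ _ _ r sch k f₀ f₁ ε B hε hQ hB
  haveI : IsProbabilityMeasure (wilsonMeasure (d := 4) (L := sch.side k) (G := G) r.ρ (sch.β k)) :=
    isProbabilityMeasure_wilsonMeasure r.ρ r.continuous (sch.β k)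
  obtain ⟨C, hC⟩ := exists_bound_smearedLatticeField r.curvature.bounded
    (Literature.Probability.LatticeModels.box 4 (sch.L k)) (sch.a k) (sch.c r.curvature k)
    (sch.m r.curvature k) f₀
  obtain ⟨K, hK⟩ := exists_bound_smearedLatticeField r.curvature.bounded
    (Literature.Probability.LatticeModels.box 4 (sch.L k)) (sch.a k) (sch.c r.curvature k)
    (sch.m r.curvature k) f₁
  exact cauchyTransfer_abs_covariance_le _ _ _ hε (cauchyTransfer_hasDerivAt_tilted_zero
    (measurable_smearedLatticeField_torusLift r.curvature _ _ _ _ f₀ (sch.side k))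
    (measurable_smearedLatticeField_torusLift r.curvature _ _ _ _ f₁ (sch.side k))
    (fun U => hC _) (fun U => hK _)) hQ hB

end Summit.QuantumFields.YangMills.Cruxes.HypercubicLimit.CouplingResponse

end
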